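import Literature.Computability.AlgebraicComplexity.LaserFormatMethod
import Literature.Computability.AlgebraicComplexity.LaserComponentTools
import Literature.Computability.AlgebraicComplexity.QuantumFunctionalsKronecker
import Literature.Computability.AlgebraicComplexity.LaserSymmetrizationEntropy
import HarnessLib

/-!
# Pooling: the laser method in format currency on a Kronecker product of two partitioned tensors

Coppersmith's 1997 rectangular bound `α > 0.29462` combines instances of the
Coppersmith–Winograd construction for *distinct* values of `q` (Le Gall 2012, p. 4: "several
instances for distinct values of q are combined").  In the language of
`LaserFormatMethod.lean` this is ONE application of the laser method to the Kronecker product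
`t ⊗ t'` of two tight partitioned tensors, read with PAIR labels (Le Gall 2014 §5: the support of
`t ⊗ t'` consists of pairs of support triples and the pair component is the Kronecker product of
the components):

* the product support `pairSupport S S'` is tight for the concatenated tightness maps
  `appendRows α α'` (values in `Fin (r + r') → ℤ`);
* the pair component has the product format value (`partSubtensor_kronecker` +
  `HasFormatValue.kronecker`);
* for rational laws `P = c/d` on `S` and `P' = c'/d'` on `S'` the product law
  `pairLaw P P' = P ⊗ P'` has counts `c·c'` over `d·d'`, its three marginals are the products of
  the marginals, so **each marginal entropy is the SUM** `H_m(P) + H_m(P')`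
  (`shannonEntropy_mul_eq`), and the weighted products of values / formats multiply.

Hence (`laserMethod_hasFormatValue_pair_of_counts`)

  `HasFormatValue (t ⊗ t') (2^{min_m (H_m(P)+H_m(P')) − Γ_{S×S'}(P⊗P')} · Πv^P · Πv'^{P'})
     (ΠfA^P · ΠfA'^{P'}) (ΠfB^P · ΠfB'^{P'}) (ΠfC^P · ΠfC'^{P'})`

— the exponent is the minimum of the POOLED entropies, not the pool of the minima (which is all
that `HasFormatValue.kronecker` of the two separate laser bounds gives); this is the whole gain of
mixing `q`'s.  When both laws are of product form on their supports (e.g. every positive law on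
the six first-power CW patterns), so is `P ⊗ P'`, and the penalty vanishes
(`maxEntropyPenalty_pairLaw_eq_zero_of_mul`, from
`LaserComponentTools.maxEntropyPenalty_eq_zero_of_mul`): `laserMethod_hasFormatValue_pair_of_mul`.
Iterating the theorem (its output feeds `hval` of the next application only through
`HasFormatValue`, so weights `u : v` are realised by nesting, `(t ⊗ t') ⊗ t'`, …) and reading with
`omegaRect_one_mid_one_le_of_hasFormatValue` gives Coppersmith-1997-type bounds on `ω(1,k,1)`.

References: D. Coppersmith, *Rectangular matrix multiplication revisited*, J. Complexity 13
(1997), §3 [Coppersmith1997]; F. Le Gall, *Powers of tensors and fast matrix multiplication*,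
ISSAC 2014, §5 [LeGall2014]; F. Le Gall, *Faster algorithms for rectangular matrix
multiplication*, FOCS 2012, arXiv:1204.1111, §1 p. 4 and Thm 2.1 [LeGall2012].
-/

set_option autoImplicit false
set_option linter.style.longLine false
set_option linter.unusedSectionVars false
set_option linter.unusedVariables false

noncomputable section

open Finset Real
open scoped BigOperators

universe u

namespace Literature.Computability.AlgebraicComplexity

open Literature.Barriers.MatrixMultiplication

/-! ## Pair labels -/

section PairLabels

variable {I J L I' J' L' : Type*}

/-- The first-factor label triple `(i,j,l)` of a pair label `((i,i'),(j,j'),(l,l'))`.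
[cite: LeGall2014, §5 (p. 10)] -/
def pairFst (s : (I × I') × (J × J') × (L × L')) : I × J × L := (s.1.1, s.2.1.1, s.2.2.1)

/-- The second-factor label triple `(i',j',l')` of a pair label `((i,i'),(j,j'),(l,l'))`.
[cite: LeGall2014, §5 (p. 10)] -/
def pairSnd (s : (I × I') × (J × J') × (L × L')) : I' × J' × L' := (s.1.2, s.2.1.2, s.2.2.2)

/-- Regrouping pair labels as pairs of label triples. [cite: LeGall2014, §5 (p. 10)] -/
def pairLabelEquiv : ((I × I') × (J × J') × (L × L')) ≃ (I × J × L) × (I' × J' × L') where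
  toFun s := (pairFst s, pairSnd s)
  invFun p := ((p.1.1, p.2.1), (p.1.2.1, p.2.2.1), (p.1.2.2, p.2.2.2))
  left_inv := fun ⟨⟨_, _⟩, ⟨_, _⟩, ⟨_, _⟩⟩ => rfl
  right_inv := fun ⟨⟨_, _, _⟩, ⟨_, _, _⟩⟩ => rfl

/-- Unfolding of the regrouping equivalence. [cite: LeGall2014, §5 (p. 10)] -/
@[simp] theorem pairLabelEquiv_apply (s : (I × I') × (J × J') × (L × L')) :
    pairLabelEquiv s = (pairFst s, pairSnd s) := rfl

/-- The product law `P ⊗ P'` on pair labels. [cite: LeGall2014, §5 (p. 10)] -/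
def pairLaw (P : I × J × L → ℝ) (P' : I' × J' × L' → ℝ) :
    (I × I') × (J × J') × (L × L') → ℝ :=
  fun s => P (pairFst s) * P' (pairSnd s)

/-- The product of two block data (values or formats) on pair labels.
[cite: LeGall2014, §5 (p. 10)] -/
def pairVal (v : I × J × L → ℝ) (v' : I' × J' × L' → ℝ) :
    (I × I') × (J × J') × (L × L') → ℝ :=
  fun s => v (pairFst s) * v' (pairSnd s)

/-- Concatenation of two tightness maps: `(i,i') ↦ (α i, α' i') ∈ ℤ^{r+r'}`.
[cite: LeGall2014, §5 (p. 10)] -/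
def appendRows {r r' : ℕ} (α : I → Fin r → ℤ) (α' : I' → Fin r' → ℤ) :
    I × I' → Fin (r + r') → ℤ :=
  fun i => Fin.append (α i.1) (α' i.2)

/-- The first `r` coordinates of the concatenated map are `α`. [cite: LeGall2014, §5 (p. 10)] -/
theorem appendRows_castAdd {r r' : ℕ} (α : I → Fin r → ℤ) (α' : I' → Fin r' → ℤ) (i : I × I')
    (k : Fin r) : appendRows α α' i (Fin.castAdd r' k) = α i.1 k := by
  simp [appendRows, Fin.append_left]

/-- The last `r'` coordinates of the concatenated map are `α'`. [cite: LeGall2014, §5 (p. 10)] -/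
theorem appendRows_natAdd {r r' : ℕ} (α : I → Fin r → ℤ) (α' : I' → Fin r' → ℤ) (i : I × I')
    (k : Fin r') : appendRows α α' i (Fin.natAdd r k) = α' i.2 k := by
  simp [appendRows, Fin.append_right]

/-- Concatenated injective maps are injective on pairs. [cite: LeGall2014, §5 (p. 10)] -/
theorem appendRows_injective {r r' : ℕ} {α : I → Fin r → ℤ} {α' : I' → Fin r' → ℤ}
    (hα : Function.Injective α) (hα' : Function.Injective α') :
    Function.Injective (appendRows α α') := by
  intro i j h
  have h1 : α i.1 = α j.1 := funext fun k => by
    have := congrFun h (Fin.castAdd r' k)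
    rwa [appendRows_castAdd, appendRows_castAdd] at this
  have h2 : α' i.2 = α' j.2 := funext fun k => by
    have := congrFun h (Fin.natAdd r k)
    rwa [appendRows_natAdd, appendRows_natAdd] at this
  exact Prod.ext (hα h1) (hα' h2)

/-- The concatenated maps are bounded by the larger bound. [cite: LeGall2014, §5 (p. 10)] -/
theorem abs_appendRows_le {r r' b b' : ℕ} {α : I → Fin r → ℤ} {α' : I' → Fin r' → ℤ}
    (hαb : ∀ i k, |α i k| ≤ b) (hα'b : ∀ i k, |α' i k| ≤ b') (i : I × I') (k : Fin (r + r')) :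
    |appendRows α α' i k| ≤ ((max b b' : ℕ) : ℤ) := by
  induction k using Fin.addCases with
  | left k =>
    rw [appendRows_castAdd]
    exact (hαb _ _).trans (by exact_mod_cast le_max_left b b')
  | right k =>
    rw [appendRows_natAdd]
    exact (hα'b _ _).trans (by exact_mod_cast le_max_right b b')

variable [Fintype I] [Fintype J] [Fintype L] [Fintype I'] [Fintype J'] [Fintype L']
  [DecidableEq I] [DecidableEq J] [DecidableEq L] [DecidableEq I'] [DecidableEq J']
  [DecidableEq L']

/-- The support of `t ⊗ t'` read with pair labels: pairs of support triples.
[cite: LeGall2014, §5 (p. 10)] -/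
def pairSupport (S : Finset (I × J × L)) (S' : Finset (I' × J' × L')) :
    Finset ((I × I') × (J × J') × (L × L')) :=
  univ.filter fun s => pairFst s ∈ S ∧ pairSnd s ∈ S'

/-- Membership in the pair support: both label triples lie in the factors' supports (Le Gall §5:
"supp(t ⊗ t′) = {((i,i′),(j,j′),(l,l′)) : (i,j,l) ∈ supp t, (i′,j′,l′) ∈ supp t′}").
[cite: LeGall2014, §5 (p. 10)] -/
theorem mem_pairSupport {S : Finset (I × J × L)} {S' : Finset (I' × J' × L')}
    {s : (I × I') × (J × J') × (L × L')} :
    s ∈ pairSupport S S' ↔ pairFst s ∈ S ∧ pairSnd s ∈ S' := by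
  simp [pairSupport]

/-- Tightness of the pair support for the concatenated maps. [cite: LeGall2014, §5 (p. 10)] -/
theorem appendRows_tight {r r' : ℕ} {S : Finset (I × J × L)} {S' : Finset (I' × J' × L')}
    {α : I → Fin r → ℤ} {β : J → Fin r → ℤ} {γ : L → Fin r → ℤ}
    {α' : I' → Fin r' → ℤ} {β' : J' → Fin r' → ℤ} {γ' : L' → Fin r' → ℤ}
    (htight : ∀ s ∈ S, ∀ k, α s.1 k + β s.2.1 k + γ s.2.2 k = 0)
    (htight' : ∀ s ∈ S', ∀ k, α' s.1 k + β' s.2.1 k + γ' s.2.2 k = 0) :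
    ∀ s ∈ pairSupport S S', ∀ k, appendRows α α' s.1 k + appendRows β β' s.2.1 k +
      appendRows γ γ' s.2.2 k = 0 := by
  intro s hs k
  obtain ⟨h1, h2⟩ := mem_pairSupport.1 hs
  induction k using Fin.addCases with
  | left k =>
    rw [appendRows_castAdd, appendRows_castAdd, appendRows_castAdd]
    exact htight _ h1 k
  | right k =>
    rw [appendRows_natAdd, appendRows_natAdd, appendRows_natAdd]
    exact htight' _ h2 k

/-- `Σ_{pairs} f(s)·g(s') = (Σ f)(Σ g)`. [cite: LeGall2014, §5 (p. 10)] -/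
theorem sum_pair_mul {M : Type*} [CommSemiring M] (f : I × J × L → M) (g : I' × J' × L' → M) :
    ∑ s : (I × I') × (J × J') × (L × L'), f (pairFst s) * g (pairSnd s) =
      (∑ s, f s) * ∑ s', g s' := by
  rw [← Fintype.sum_equiv pairLabelEquiv.symm (fun p => f p.1 * g p.2)
    (fun s => f (pairFst s) * g (pairSnd s)) (fun p => by
      obtain ⟨⟨a, b, c⟩, ⟨d, e, f⟩⟩ := p; rfl)]
  rw [Fintype.sum_prod_type, Finset.sum_mul_sum]

/-- The marginals of `P ⊗ P'` are the products of the marginals (first marginal).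
[cite: LeGall2014, §5 (p. 10)] -/
theorem marginalDist₁_pairLaw (P : I × J × L → ℝ) (P' : I' × J' × L' → ℝ) :
    marginalDist₁ (pairLaw P P') = fun i => marginalDist₁ P i.1 * marginalDist₁ P' i.2 := by
  funext i
  simp only [marginalDist₁, pairLaw, pairFst, pairSnd, Fintype.sum_prod_type, Finset.sum_mul_sum]

/-- Second marginal of `P ⊗ P'`. [cite: LeGall2014, §5 (p. 10)] -/
theorem marginalDist₂_pairLaw (P : I × J × L → ℝ) (P' : I' × J' × L' → ℝ) :
    marginalDist₂ (pairLaw P P') = fun j => marginalDist₂ P j.1 * marginalDist₂ P' j.2 := by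
  funext j
  simp only [marginalDist₂, pairLaw, pairFst, pairSnd, Fintype.sum_prod_type, Finset.sum_mul_sum]

/-- Third marginal of `P ⊗ P'`. [cite: LeGall2014, §5 (p. 10)] -/
theorem marginalDist₃_pairLaw (P : I × J × L → ℝ) (P' : I' × J' × L' → ℝ) :
    marginalDist₃ (pairLaw P P') = fun l => marginalDist₃ P l.1 * marginalDist₃ P' l.2 := by
  funext l
  simp only [marginalDist₃, pairLaw, pairFst, pairSnd, Fintype.sum_prod_type, Finset.sum_mul_sum]

/-- **Marginal entropies of `P ⊗ P'` add.** [cite: LeGall2014, §5 (p. 10) and App. A.3] -/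
theorem shannonEntropy_marginals_pairLaw {P : I × J × L → ℝ} {P' : I' × J' × L' → ℝ}
    (hP1 : ∑ s, P s = 1) (hP'1 : ∑ s, P' s = 1) :
    shannonEntropy (marginalDist₁ (pairLaw P P')) =
        shannonEntropy (marginalDist₁ P) + shannonEntropy (marginalDist₁ P') ∧
      shannonEntropy (marginalDist₂ (pairLaw P P')) =
        shannonEntropy (marginalDist₂ P) + shannonEntropy (marginalDist₂ P') ∧
      shannonEntropy (marginalDist₃ (pairLaw P P')) =
        shannonEntropy (marginalDist₃ P) + shannonEntropy (marginalDist₃ P') := by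
  obtain ⟨h1, h2, h3⟩ := sum_marginalDist₁₂₃ hP1
  obtain ⟨h1', h2', h3'⟩ := sum_marginalDist₁₂₃ hP'1
  exact ⟨by rw [marginalDist₁_pairLaw, shannonEntropy_mul_eq h1 h1'],
    by rw [marginalDist₂_pairLaw, shannonEntropy_mul_eq h2 h2'],
    by rw [marginalDist₃_pairLaw, shannonEntropy_mul_eq h3 h3']⟩

/-- **Weighted products over the pair support split**:
`Π_{(s,s')} (v_s v'_{s'})^{P_s P'_{s'}} = Π_s v_s^{P_s} · Π_{s'} v'_{s'}^{P'_{s'}}` for laws of mass one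
on `S`, `S'`. [cite: LeGall2014, §5 (p. 10)] -/
theorem prod_pairSupport_pairVal_rpow (S : Finset (I × J × L)) (S' : Finset (I' × J' × L'))
    (v : I × J × L → ℝ) (v' : I' × J' × L' → ℝ) (P : I × J × L → ℝ) (P' : I' × J' × L' → ℝ)
    (hv : ∀ s ∈ S, 0 < v s) (hv' : ∀ s' ∈ S', 0 < v' s') (hP1 : ∑ s ∈ S, P s = 1)
    (hP'1 : ∑ s' ∈ S', P' s' = 1) :
    ∏ s ∈ pairSupport S S', pairVal v v' s ^ pairLaw P P' s =
      (∏ s ∈ S, v s ^ P s) * ∏ s' ∈ S', v' s' ^ P' s' := by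
  have hre : ∏ s ∈ pairSupport S S', pairVal v v' s ^ pairLaw P P' s =
      ∏ p ∈ S ×ˢ S', (v p.1 * v' p.2) ^ (P p.1 * P' p.2) :=
    Finset.prod_equiv pairLabelEquiv (fun s => by simp [mem_pairSupport, Finset.mem_product])
      (fun s _ => rfl)
  rw [hre, Finset.prod_product]
  have hsplit : ∀ x ∈ S, ∏ y ∈ S', (v x * v' y) ^ (P x * P' y) =
      v x ^ P x * ∏ y ∈ S', v' y ^ (P x * P' y) := by
    intro x hx
    rw [Finset.prod_congr rfl fun y hy => Real.mul_rpow (hv x hx).le (hv' y hy).le,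
      Finset.prod_mul_distrib, ← Real.rpow_sum_of_pos (hv x hx), ← Finset.mul_sum, hP'1, mul_one]
  rw [Finset.prod_congr rfl hsplit, Finset.prod_mul_distrib, Finset.prod_comm]
  congr 1
  refine Finset.prod_congr rfl fun y hy => ?_
  rw [← Real.rpow_sum_of_pos (hv' y hy), ← Finset.sum_mul, hP1, one_mul]

end PairLabels

/-! ## The laser method on `t ⊗ t'` with pair labels -/

section Pooling

variable {K : Type u} [Field K]
variable {ι κ μ ι' κ' μ' : Type*} [Fintype ι] [Fintype κ] [Fintype μ] [Fintype ι'] [Fintype κ']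
  [Fintype μ'] [DecidableEq ι] [DecidableEq κ] [DecidableEq μ] [DecidableEq ι'] [DecidableEq κ']
  [DecidableEq μ']
variable {I J L I' J' L' : Type*} [Fintype I] [Fintype J] [Fintype L] [Fintype I'] [Fintype J']
  [Fintype L'] [DecidableEq I] [DecidableEq J] [DecidableEq L] [DecidableEq I'] [DecidableEq J']
  [DecidableEq L']

/-- A rational law `P = c/d` with `Σ c = d` has mass one, also over its support. [folklore] -/
private theorem sum_law_eq_one {S : Finset (I × J × L)} {c : I × J × L → ℕ}
    (hcS : ∀ s, s ∉ S → c s = 0) {d : ℕ} (hd : 0 < d) (hc : ∑ s, c s = d) {P : I × J × L → ℝ}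
    (hP : ∀ s, P s = (c s : ℝ) / d) : ∑ s, P s = 1 ∧ ∑ s ∈ S, P s = 1 := by
  have hd' : (d : ℝ) ≠ 0 := by exact_mod_cast hd.ne'
  have h1 : ∑ s, P s = 1 := by
    simp_rw [hP, ← Finset.sum_div]
    rw [← Nat.cast_sum, hc, div_self hd']
  refine ⟨h1, ?_⟩
  rw [← h1, ← Finset.sum_subset (Finset.subset_univ S) fun s _ hs => by rw [hP, hcS s hs]; simp]

set_option maxHeartbeats 800000 in
/-- **The laser method on a Kronecker product of two partitioned tensors, in format currency
(pooling).**  Laser data for `t` (support `S`, tightness `α,β,γ`, block format values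
`(v,fA,fB,fC)`, rational law `P = c/d`) and for `t'` give, for `t ⊗ t'` read with pair labels,
the count `2^{min_m (H_m(P) + H_m(P')) − Γ_{S×S'}(P ⊗ P')} · Π_S v^P · Π_{S'} v'^{P'}` and the
formats `Π_S fA^P · Π_{S'} fA'^{P'}` etc. — the minimum of the POOLED marginal entropies.
[cite: Coppersmith1997, §3; LeGall2014, §5 and Thm 4.1] -/
theorem laserMethod_hasFormatValue_pair_of_counts
    (t : ι → κ → μ → K) (bI : ι → I) (bJ : κ → J) (bL : μ → L) (S : Finset (I × J × L))
    (hS : ∀ a b c, t a b c ≠ 0 → (bI a, bJ b, bL c) ∈ S)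
    {r b : ℕ} (α : I → Fin r → ℤ) (β : J → Fin r → ℤ) (γ : L → Fin r → ℤ)
    (hα : Function.Injective α) (hβ : Function.Injective β) (hγ : Function.Injective γ)
    (hαb : ∀ i k, |α i k| ≤ b) (hβb : ∀ j k, |β j k| ≤ b)
    (htight : ∀ s ∈ S, ∀ k, α s.1 k + β s.2.1 k + γ s.2.2 k = 0)
    (v fA fB fC : I × J × L → ℝ) (hv : ∀ s ∈ S, 0 < v s) (hfA : ∀ s ∈ S, 0 < fA s)
    (hfB : ∀ s ∈ S, 0 < fB s) (hfC : ∀ s ∈ S, 0 < fC s)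
    (hval : ∀ s ∈ S, HasFormatValue (partSubtensor bI bJ bL t {s.1} {s.2.1} {s.2.2}) (v s)
      (fA s) (fB s) (fC s))
    (c : I × J × L → ℕ) (hcS : ∀ s, s ∉ S → c s = 0) {d : ℕ} (hd : 0 < d)
    (hc : ∑ s, c s = d) (P : I × J × L → ℝ) (hP : ∀ s, P s = (c s : ℝ) / d)
    (t' : ι' → κ' → μ' → K) (bI' : ι' → I') (bJ' : κ' → J') (bL' : μ' → L')
    (S' : Finset (I' × J' × L')) (hS' : ∀ a b c, t' a b c ≠ 0 → (bI' a, bJ' b, bL' c) ∈ S')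
    {r' b' : ℕ} (α' : I' → Fin r' → ℤ) (β' : J' → Fin r' → ℤ) (γ' : L' → Fin r' → ℤ)
    (hα' : Function.Injective α') (hβ' : Function.Injective β') (hγ' : Function.Injective γ')
    (hα'b : ∀ i k, |α' i k| ≤ b') (hβ'b : ∀ j k, |β' j k| ≤ b')
    (htight' : ∀ s ∈ S', ∀ k, α' s.1 k + β' s.2.1 k + γ' s.2.2 k = 0)
    (v' fA' fB' fC' : I' × J' × L' → ℝ) (hv' : ∀ s ∈ S', 0 < v' s) (hfA' : ∀ s ∈ S', 0 < fA' s)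
    (hfB' : ∀ s ∈ S', 0 < fB' s) (hfC' : ∀ s ∈ S', 0 < fC' s)
    (hval' : ∀ s ∈ S', HasFormatValue (partSubtensor bI' bJ' bL' t' {s.1} {s.2.1} {s.2.2})
      (v' s) (fA' s) (fB' s) (fC' s))
    (c' : I' × J' × L' → ℕ) (hcS' : ∀ s, s ∉ S' → c' s = 0) {d' : ℕ} (hd' : 0 < d')
    (hc' : ∑ s, c' s = d') (P' : I' × J' × L' → ℝ) (hP' : ∀ s, P' s = (c' s : ℝ) / d') :
    HasFormatValue (kroneckerTensor t t')
      ((2 : ℝ) ^ (min (shannonEntropy (marginalDist₁ P) + shannonEntropy (marginalDist₁ P'))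
          (min (shannonEntropy (marginalDist₂ P) + shannonEntropy (marginalDist₂ P'))
            (shannonEntropy (marginalDist₃ P) + shannonEntropy (marginalDist₃ P'))) -
          maxEntropyPenalty (pairSupport S S') (pairLaw P P')) *
        ((∏ s ∈ S, v s ^ P s) * ∏ s' ∈ S', v' s' ^ P' s'))
      ((∏ s ∈ S, fA s ^ P s) * ∏ s' ∈ S', fA' s' ^ P' s')
      ((∏ s ∈ S, fB s ^ P s) * ∏ s' ∈ S', fB' s' ^ P' s')
      ((∏ s ∈ S, fC s ^ P s) * ∏ s' ∈ S', fC' s' ^ P' s') := by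
  classical
  obtain ⟨hP1, hPS1⟩ := sum_law_eq_one hcS hd hc hP
  obtain ⟨hP'1, hP'S1⟩ := sum_law_eq_one hcS' hd' hc' hP'
  -- hypotheses of the laser method for the pair data
  have hS₀ : ∀ a b c, kroneckerTensor t t' a b c ≠ 0 →
      ((fun x : ι × ι' => (bI x.1, bI' x.2)) a, (fun y : κ × κ' => (bJ y.1, bJ' y.2)) b,
        (fun z : μ × μ' => (bL z.1, bL' z.2)) c) ∈ pairSupport S S' := by
    intro a b c h
    rw [kroneckerTensor_apply] at h
    obtain ⟨h1, h2⟩ := mul_ne_zero_iff.mp h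
    rw [mem_pairSupport]
    exact ⟨hS a.1 b.1 c.1 h1, hS' a.2 b.2 c.2 h2⟩
  have hpos : ∀ (f : I × J × L → ℝ) (f' : I' × J' × L' → ℝ), (∀ s ∈ S, 0 < f s) →
      (∀ s ∈ S', 0 < f' s) → ∀ s ∈ pairSupport S S', 0 < pairVal f f' s := by
    intro f f' hf hf' s hs
    obtain ⟨h1, h2⟩ := mem_pairSupport.1 hs
    exact mul_pos (hf _ h1) (hf' _ h2)
  have hval₀ : ∀ s ∈ pairSupport S S', HasFormatValue
      (partSubtensor (fun x : ι × ι' => (bI x.1, bI' x.2)) (fun y : κ × κ' => (bJ y.1, bJ' y.2))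
        (fun z : μ × μ' => (bL z.1, bL' z.2)) (kroneckerTensor t t') {s.1} {s.2.1} {s.2.2})
      (pairVal v v' s) (pairVal fA fA' s) (pairVal fB fB' s) (pairVal fC fC' s) := by
    intro s hs
    obtain ⟨h1, h2⟩ := mem_pairSupport.1 hs
    obtain ⟨⟨i, i'⟩, ⟨j, j'⟩, ⟨l, l'⟩⟩ := s
    simp only [pairFst, pairSnd] at h1 h2
    simp only [pairVal, pairFst, pairSnd]
    rw [partSubtensor_kronecker bI bJ bL bI' bJ' bL' t t' i j l i' j' l']
    exact (hval (i, j, l) h1).kronecker (hval' (i', j', l') h2) (hv _ h1).le (hv' _ h2).le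
      (hfA _ h1).le (hfA' _ h2).le (hfB _ h1).le (hfB' _ h2).le (hfC _ h1).le (hfC' _ h2).le
  have hcS₀ : ∀ s, s ∉ pairSupport S S' → c (pairFst s) * c' (pairSnd s) = 0 := by
    intro s hs
    rw [mem_pairSupport, not_and_or] at hs
    rcases hs with hs | hs
    · rw [hcS _ hs, zero_mul]
    · rw [hcS' _ hs, mul_zero]
  have hc₀ : ∑ s, c (pairFst s) * c' (pairSnd s) = d * d' := by rw [sum_pair_mul, hc, hc']
  have hP₀ : ∀ s, pairLaw P P' s = ((c (pairFst s) * c' (pairSnd s) : ℕ) : ℝ) / (d * d' : ℕ) := by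
    intro s
    simp only [pairLaw, hP, hP', Nat.cast_mul]
    rw [div_mul_div_comm]
  have key := laserMethod_hasFormatValue_of_counts (kroneckerTensor t t')
    (fun x : ι × ι' => (bI x.1, bI' x.2)) (fun y : κ × κ' => (bJ y.1, bJ' y.2))
    (fun z : μ × μ' => (bL z.1, bL' z.2)) (pairSupport S S') hS₀
    (appendRows α α') (appendRows β β') (appendRows γ γ')
    (appendRows_injective hα hα') (appendRows_injective hβ hβ') (appendRows_injective hγ hγ')
    (abs_appendRows_le hαb hα'b) (abs_appendRows_le hβb hβ'b) (appendRows_tight htight htight')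
    (pairVal v v') (pairVal fA fA') (pairVal fB fB') (pairVal fC fC')
    (hpos v v' hv hv') (hpos fA fA' hfA hfA') (hpos fB fB' hfB hfB') (hpos fC fC' hfC hfC')
    hval₀ (fun s => c (pairFst s) * c' (pairSnd s)) hcS₀ (mul_pos hd hd') hc₀ (pairLaw P P') hP₀
  obtain ⟨e1, e2, e3⟩ := shannonEntropy_marginals_pairLaw hP1 hP'1
  rw [e1, e2, e3, prod_pairSupport_pairVal_rpow S S' v v' P P' hv hv' hPS1 hP'S1,
    prod_pairSupport_pairVal_rpow S S' fA fA' P P' hfA hfA' hPS1 hP'S1,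
    prod_pairSupport_pairVal_rpow S S' fB fB' P P' hfB hfB' hPS1 hP'S1,
    prod_pairSupport_pairVal_rpow S S' fC fC' P P' hfC hfC' hPS1 hP'S1] at key
  exact key

/-- **Product-form laws pool with zero penalty.**  If `P` and `P'` are of product form
`f(i)g(j)h(l)` on their supports (and vanish off them), so is `P ⊗ P'` on the pair support, and
`Γ_{S×S'}(P ⊗ P') = 0`. [cite: LeGall2014, §5 (p. 10); Coppersmith1997, §3] -/
theorem maxEntropyPenalty_pairLaw_eq_zero_of_mul (S : Finset (I × J × L))
    (S' : Finset (I' × J' × L')) {P : I × J × L → ℝ} {P' : I' × J' × L' → ℝ}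
    (hP0 : ∀ s, 0 ≤ P s) (hPS : ∀ s, s ∉ S → P s = 0) (hP1 : ∑ s, P s = 1)
    (hP'0 : ∀ s, 0 ≤ P' s) (hP'S : ∀ s, s ∉ S' → P' s = 0) (hP'1 : ∑ s, P' s = 1)
    (f : I → ℝ) (g : J → ℝ) (h : L → ℝ) (hf : ∀ x ∈ S, 0 < f x.1) (hg : ∀ x ∈ S, 0 < g x.2.1)
    (hh : ∀ x ∈ S, 0 < h x.2.2) (hprod : ∀ x ∈ S, P x = f x.1 * g x.2.1 * h x.2.2)
    (f' : I' → ℝ) (g' : J' → ℝ) (h' : L' → ℝ) (hf' : ∀ x ∈ S', 0 < f' x.1)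
    (hg' : ∀ x ∈ S', 0 < g' x.2.1) (hh' : ∀ x ∈ S', 0 < h' x.2.2)
    (hprod' : ∀ x ∈ S', P' x = f' x.1 * g' x.2.1 * h' x.2.2) :
    maxEntropyPenalty (pairSupport S S') (pairLaw P P') = 0 := by
  classical
  have hzero : ∀ s, s ∉ pairSupport S S' → pairLaw P P' s = 0 := by
    intro s hs
    rw [mem_pairSupport, not_and_or] at hs
    rcases hs with hs | hs
    · simp [pairLaw, hPS _ hs]
    · simp [pairLaw, hP'S _ hs]
  have hsimplex : pairLaw P P' ∈ stdSimplex ℝ ((I × I') × (J × J') × (L × L')) := by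
    refine ⟨fun s => mul_nonneg (hP0 _) (hP'0 _), ?_⟩
    show ∑ s, P (pairFst s) * P' (pairSnd s) = 1
    rw [sum_pair_mul, hP1, hP'1, mul_one]
  refine maxEntropyPenalty_eq_zero_of_mul (pairSupport S S') hsimplex hzero
    (fun i => f i.1 * f' i.2) (fun j => g j.1 * g' j.2) (fun l => h l.1 * h' l.2)
    (fun x hx => ?_) (fun x hx => ?_) (fun x hx => ?_) (fun x hx => ?_)
  · obtain ⟨h1, h2⟩ := mem_pairSupport.1 hx; exact mul_pos (hf _ h1) (hf' _ h2)
  · obtain ⟨h1, h2⟩ := mem_pairSupport.1 hx; exact mul_pos (hg _ h1) (hg' _ h2)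
  · obtain ⟨h1, h2⟩ := mem_pairSupport.1 hx; exact mul_pos (hh _ h1) (hh' _ h2)
  · obtain ⟨h1, h2⟩ := mem_pairSupport.1 hx
    simp only [pairLaw]
    rw [hprod _ h1, hprod' _ h2]
    simp only [pairFst, pairSnd]
    ring

/-- **Pooling with product-form laws** (Coppersmith 1997's mechanism: instances of the CW
construction for two values of `q`, combined): the count exponent is exactly
`min_m (H_m(P) + H_m(P'))`, with no penalty. [cite: Coppersmith1997, §3; LeGall2014, Thm 4.1] -/
theorem laserMethod_hasFormatValue_pair_of_mul
    (t : ι → κ → μ → K) (bI : ι → I) (bJ : κ → J) (bL : μ → L) (S : Finset (I × J × L))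
    (hS : ∀ a b c, t a b c ≠ 0 → (bI a, bJ b, bL c) ∈ S)
    {r b : ℕ} (α : I → Fin r → ℤ) (β : J → Fin r → ℤ) (γ : L → Fin r → ℤ)
    (hα : Function.Injective α) (hβ : Function.Injective β) (hγ : Function.Injective γ)
    (hαb : ∀ i k, |α i k| ≤ b) (hβb : ∀ j k, |β j k| ≤ b)
    (htight : ∀ s ∈ S, ∀ k, α s.1 k + β s.2.1 k + γ s.2.2 k = 0)
    (v fA fB fC : I × J × L → ℝ) (hv : ∀ s ∈ S, 0 < v s) (hfA : ∀ s ∈ S, 0 < fA s)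
    (hfB : ∀ s ∈ S, 0 < fB s) (hfC : ∀ s ∈ S, 0 < fC s)
    (hval : ∀ s ∈ S, HasFormatValue (partSubtensor bI bJ bL t {s.1} {s.2.1} {s.2.2}) (v s)
      (fA s) (fB s) (fC s))
    (c : I × J × L → ℕ) (hcS : ∀ s, s ∉ S → c s = 0) {d : ℕ} (hd : 0 < d)
    (hc : ∑ s, c s = d) (P : I × J × L → ℝ) (hP : ∀ s, P s = (c s : ℝ) / d)
    (f : I → ℝ) (g : J → ℝ) (h : L → ℝ) (hf : ∀ x ∈ S, 0 < f x.1) (hg : ∀ x ∈ S, 0 < g x.2.1)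
    (hh : ∀ x ∈ S, 0 < h x.2.2) (hprod : ∀ x ∈ S, P x = f x.1 * g x.2.1 * h x.2.2)
    (t' : ι' → κ' → μ' → K) (bI' : ι' → I') (bJ' : κ' → J') (bL' : μ' → L')
    (S' : Finset (I' × J' × L')) (hS' : ∀ a b c, t' a b c ≠ 0 → (bI' a, bJ' b, bL' c) ∈ S')
    {r' b' : ℕ} (α' : I' → Fin r' → ℤ) (β' : J' → Fin r' → ℤ) (γ' : L' → Fin r' → ℤ)
    (hα' : Function.Injective α') (hβ' : Function.Injective β') (hγ' : Function.Injective γ')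
    (hα'b : ∀ i k, |α' i k| ≤ b') (hβ'b : ∀ j k, |β' j k| ≤ b')
    (htight' : ∀ s ∈ S', ∀ k, α' s.1 k + β' s.2.1 k + γ' s.2.2 k = 0)
    (v' fA' fB' fC' : I' × J' × L' → ℝ) (hv' : ∀ s ∈ S', 0 < v' s) (hfA' : ∀ s ∈ S', 0 < fA' s)
    (hfB' : ∀ s ∈ S', 0 < fB' s) (hfC' : ∀ s ∈ S', 0 < fC' s)
    (hval' : ∀ s ∈ S', HasFormatValue (partSubtensor bI' bJ' bL' t' {s.1} {s.2.1} {s.2.2})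
      (v' s) (fA' s) (fB' s) (fC' s))
    (c' : I' × J' × L' → ℕ) (hcS' : ∀ s, s ∉ S' → c' s = 0) {d' : ℕ} (hd' : 0 < d')
    (hc' : ∑ s, c' s = d') (P' : I' × J' × L' → ℝ) (hP' : ∀ s, P' s = (c' s : ℝ) / d')
    (f' : I' → ℝ) (g' : J' → ℝ) (h' : L' → ℝ) (hf' : ∀ x ∈ S', 0 < f' x.1)
    (hg' : ∀ x ∈ S', 0 < g' x.2.1) (hh' : ∀ x ∈ S', 0 < h' x.2.2)
    (hprod' : ∀ x ∈ S', P' x = f' x.1 * g' x.2.1 * h' x.2.2) :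
    HasFormatValue (kroneckerTensor t t')
      ((2 : ℝ) ^ (min (shannonEntropy (marginalDist₁ P) + shannonEntropy (marginalDist₁ P'))
          (min (shannonEntropy (marginalDist₂ P) + shannonEntropy (marginalDist₂ P'))
            (shannonEntropy (marginalDist₃ P) + shannonEntropy (marginalDist₃ P')))) *
        ((∏ s ∈ S, v s ^ P s) * ∏ s' ∈ S', v' s' ^ P' s'))
      ((∏ s ∈ S, fA s ^ P s) * ∏ s' ∈ S', fA' s' ^ P' s')
      ((∏ s ∈ S, fB s ^ P s) * ∏ s' ∈ S', fB' s' ^ P' s')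
      ((∏ s ∈ S, fC s ^ P s) * ∏ s' ∈ S', fC' s' ^ P' s') := by
  have hP0 : ∀ s, 0 ≤ P s := fun s => by rw [hP]; positivity
  have hP'0 : ∀ s, 0 ≤ P' s := fun s => by rw [hP']; positivity
  have hPS : ∀ s, s ∉ S → P s = 0 := fun s hs => by rw [hP, hcS s hs]; simp
  have hP'S : ∀ s, s ∉ S' → P' s = 0 := fun s hs => by rw [hP', hcS' s hs]; simp
  have key := laserMethod_hasFormatValue_pair_of_counts t bI bJ bL S hS α β γ hα hβ hγ hαb hβb
    htight v fA fB fC hv hfA hfB hfC hval c hcS hd hc P hP t' bI' bJ' bL' S' hS' α' β' γ' hα' hβ'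
    hγ' hα'b hβ'b htight' v' fA' fB' fC' hv' hfA' hfB' hfC' hval' c' hcS' hd' hc' P' hP'
  rwa [maxEntropyPenalty_pairLaw_eq_zero_of_mul S S' hP0 hPS (sum_law_eq_one hcS hd hc hP).1
    hP'0 hP'S (sum_law_eq_one hcS' hd' hc' hP').1 f g h hf hg hh hprod f' g' h' hf' hg' hh'
    hprod', sub_zero] at key

end Pooling

end Literature.Computability.AlgebraicComplexity
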